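import Summits.AtomisticToContinuum.FouriersLaw.Theorems.OddSectorIrreversibilityTapLeakBoundBlockConeCurrent
import Summits.AtomisticToContinuum.FouriersLaw.Theorems.OddSectorIrreversibilityCorrectorTheorySiteEnergy

/-!
# `TapLeakBound` (stmt-AtomisticToContinuum-15159), line `SketchIdeator2`: block light cone — site energies control the box

Helper file (`--supports stmt-AtomisticToContinuum-15159`) for crux
P = `Summit.AtomisticToContinuum.FouriersLaw.Theses.OddSectorIrreversibility.TapLeakBound`, registered stub `stub_kickCone`
(C′ `ResampledKickCone`). The deterministic block light cone (`…BlockConePrelim/Site/BlockCone/BlockConeCurrent.lean`)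
is conditioned on a POSITION BOX along both trajectories; the natural event for the probabilistic half is an ENERGY cap on the
block. This file supplies the deterministic links (site energy `h_m` = the weighted energy of `…CorrectorTheorySiteEnergy`
with weight `[· = m]`, passed as the hypothesis `hX`, no new definition):

* `half_sq_snd_le_siteEnergy`, `quarter_pow_four_fst_le_siteEnergy` — `p_m²/2 ≤ h_m`, `lam q_m⁴/4 ≤ h_m` (pinned chain);
* `abs_fst_le_of_siteEnergy_le`, `abs_snd_le_of_siteEnergy_le` — `h_m ≤ E`, `4E/lam ≤ R⁴`, `2E ≤ P²` ⇒ `|q_m| ≤ R`, `|p_m| ≤ P`;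
* `liouvilleOp_siteEnergy_zero` — the energy balance at the LEFT END site: `X_H h_0 = -j_0` (no inflow bond);
* `siteEnergy_detFlow_le_interior`, `siteEnergy_detFlow_le_zero` (registered sub-goal `stub_blockEnergyBalance`) —
  **sup-in-time control of a site energy along the closed flow by the time-integrated adjacent currents**:
  `h_m(Φ_t x) ≤ h_m(x) + ∫₀ᵗ (|j_{m-1}| + |j_m|)(Φ_τ x) dτ` (`t ≥ 0`; only `|j_0|` at the left end) — the deterministic
  side of the maximal inequality (Gibbs moments of `∫|j|` then follow from the invariance of `μ_T` under `Φ`).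

References: folklore (local energy conservation, BLR 2000 §5.2). Nothing here closes the item.
-/

noncomputable section

open MeasureTheory Filter Topology Set Function Metric
open scoped NNReal

namespace Summit.AtomisticToContinuum.FouriersLaw.Theorems.OddSectorIrreversibility.TapLeak

open Literature.MathematicalPhysics.KineticTheory.HeatConduction
open Literature.MathematicalPhysics.KineticTheory
open Summit.AtomisticToContinuum.FouriersLaw.Theorems.SuperadditiveResistance.DeviceLiouville
open Summit.AtomisticToContinuum.FouriersLaw.Theorems.OddSectorIrreversibility.Corrector

variable {N : ℕ}

/-! ### §9 The site energy bounds the coordinates -/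

section Static

variable (P : OscillatorChain) (m : Fin N) (X : PhaseSpace N → ℝ)
  (hX : X = fun x => (∑ k : Fin N, (if k = m then (1 : ℝ) else 0) * (x.2 k ^ 2 / 2 + P.U (x.1 k))) +
    ∑ k : Fin N, ∑ l : Fin N,
      if l.val = k.val + 1 then ((if k = m then (1 : ℝ) else 0) + (if l = m then (1 : ℝ) else 0)) / 2 *
        P.V (x.1 l - x.1 k) else 0)
include hX

/-- The on-site part is below the site energy: `p_m²/2 + U(q_m) ≤ h_m` for `V ≥ 0`. [folklore] -/
theorem onsite_le_siteEnergy (hV0 : ∀ r, 0 ≤ P.V r) (x : PhaseSpace N) :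
    x.2 m ^ 2 / 2 + P.U (x.1 m) ≤ X x := by
  subst hX
  have h1 : ∑ k : Fin N, (if k = m then (1 : ℝ) else 0) * (x.2 k ^ 2 / 2 + P.U (x.1 k)) =
      x.2 m ^ 2 / 2 + P.U (x.1 m) := by
    rw [Finset.sum_eq_single_of_mem m (Finset.mem_univ _)]
    · simp
    · intro k _ hk; simp [hk]
  have h2 : 0 ≤ ∑ k : Fin N, ∑ l : Fin N,
      (if l.val = k.val + 1 then ((if k = m then (1 : ℝ) else 0) + (if l = m then (1 : ℝ) else 0)) / 2 *
        P.V (x.1 l - x.1 k) else 0) := by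
    refine Finset.sum_nonneg fun k _ => Finset.sum_nonneg fun l _ => ?_
    split_ifs
    · have := hV0 (x.1 l - x.1 k); positivity
    · have := hV0 (x.1 l - x.1 k); positivity
    · have := hV0 (x.1 l - x.1 k); positivity
    · have := hV0 (x.1 l - x.1 k); positivity
    · exact le_rfl
  simp only [h1]
  linarith

end Static

section Pinned

variable {ω₂ lam β : ℝ} (hω : 0 ≤ ω₂) (hl : 0 ≤ lam) (hβ : 0 ≤ β) (m : Fin N) (X : PhaseSpace N → ℝ)
  (hX : X = fun x => (∑ k : Fin N, (if k = m then (1 : ℝ) else 0) * (x.2 k ^ 2 / 2 + (pinnedChain ω₂ lam β 0).U (x.1 k))) +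
    ∑ k : Fin N, ∑ l : Fin N,
      if l.val = k.val + 1 then ((if k = m then (1 : ℝ) else 0) + (if l = m then (1 : ℝ) else 0)) / 2 *
        (pinnedChain ω₂ lam β 0).V (x.1 l - x.1 k) else 0)
include hω hl hβ hX

/-- **`p_m²/2 ≤ h_m`.** [folklore] -/
theorem half_sq_snd_le_siteEnergy (x : PhaseSpace N) : x.2 m ^ 2 / 2 ≤ X x := by
  have hV0 : ∀ r, 0 ≤ (pinnedChain ω₂ lam β 0).V r := fun r => by
    show 0 ≤ r ^ 2 / 2 + β * r ^ 4 / 4; positivity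
  have h := onsite_le_siteEnergy (pinnedChain ω₂ lam β 0) m X hX hV0 x
  have hU : 0 ≤ (pinnedChain ω₂ lam β 0).U (x.1 m) := by
    show 0 ≤ ω₂ * x.1 m ^ 2 / 2 + lam * x.1 m ^ 4 / 4
    positivity
  linarith

omit hl in
/-- **`lam q_m⁴/4 ≤ h_m`.** [folklore] -/
theorem quarter_pow_four_fst_le_siteEnergy (x : PhaseSpace N) : lam * x.1 m ^ 4 / 4 ≤ X x := by
  have hV0 : ∀ r, 0 ≤ (pinnedChain ω₂ lam β 0).V r := fun r => by
    show 0 ≤ r ^ 2 / 2 + β * r ^ 4 / 4; positivity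
  have h := onsite_le_siteEnergy (pinnedChain ω₂ lam β 0) m X hX hV0 x
  have hU : (pinnedChain ω₂ lam β 0).U (x.1 m) = ω₂ * x.1 m ^ 2 / 2 + lam * x.1 m ^ 4 / 4 := rfl
  have hp : 0 ≤ x.2 m ^ 2 / 2 := by positivity
  have hq : 0 ≤ ω₂ * x.1 m ^ 2 / 2 := by positivity
  linarith

omit hl in
/-- **Energy cap ⇒ position box**: `h_m ≤ E`, `lam > 0`, `4E/lam ≤ R⁴`, `R ≥ 0` ⇒ `|q_m| ≤ R`. [folklore] -/
theorem abs_fst_le_of_siteEnergy_le (hl' : 0 < lam) {E R : ℝ} (hR : 0 ≤ R) (hER : 4 * E / lam ≤ R ^ 4)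
    {x : PhaseSpace N} (hE : X x ≤ E) : |x.1 m| ≤ R := by
  have h := quarter_pow_four_fst_le_siteEnergy hω hβ m X hX x
  have h4 : |x.1 m| ^ 4 ≤ R ^ 4 := by
    have e : |x.1 m| ^ 4 = x.1 m ^ 4 := by
      rw [show (4 : ℕ) = 2 * 2 from rfl, pow_mul, pow_mul, sq_abs]
    rw [e]
    have : x.1 m ^ 4 ≤ 4 * E / lam := by
      rw [le_div_iff₀ hl']; linarith
    exact this.trans hER
  exact (pow_le_pow_iff_left₀ (abs_nonneg _) hR (by norm_num)).1 h4

/-- **Energy cap ⇒ momentum box**: `h_m ≤ E`, `2E ≤ P²`, `P ≥ 0` ⇒ `|p_m| ≤ P`. [folklore] -/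
theorem abs_snd_le_of_siteEnergy_le {E Pm : ℝ} (hP : 0 ≤ Pm) (hEP : 2 * E ≤ Pm ^ 2)
    {x : PhaseSpace N} (hE : X x ≤ E) : |x.2 m| ≤ Pm := by
  have h := half_sq_snd_le_siteEnergy hω hl hβ m X hX x
  have h2 : |x.2 m| ^ 2 ≤ Pm ^ 2 := by
    rw [sq_abs]; linarith
  exact (pow_le_pow_iff_left₀ (abs_nonneg _) hP (by norm_num)).1 h2

/-! ### §10 The energy balance along the closed flow -/

omit hω hl hβ in
/-- The site energy is smooth. [folklore] -/
theorem contDiff_siteEnergy : ContDiff ℝ 1 X := by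
  subst hX
  have hU : ContDiff ℝ 1 (pinnedChain ω₂ lam β 0).U := pinnedChain_contDiff_U ω₂ lam β 0
  have hV : ContDiff ℝ 1 (pinnedChain ω₂ lam β 0).V := pinnedChain_contDiff_V ω₂ lam β 0
  have hq : ∀ k : Fin N, ContDiff ℝ 1 fun x : PhaseSpace N => x.1 k := fun k =>
    (contDiff_apply ℝ ℝ k).comp contDiff_fst
  have hp : ∀ k : Fin N, ContDiff ℝ 1 fun x : PhaseSpace N => x.2 k := fun k =>
    (contDiff_apply ℝ ℝ k).comp contDiff_snd
  refine ContDiff.add (ContDiff.sum fun k _ => ?_) (ContDiff.sum fun k _ => ContDiff.sum fun l _ => ?_)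
  · exact contDiff_const.mul ((((hp k).pow 2).div_const 2).add (hU.comp (hq k)))
  · split_ifs <;> first
      | exact contDiff_const
      | exact contDiff_const.mul (hV.comp ((hq l).sub (hq k)))

omit hω hl hβ in
/-- **Energy balance at the LEFT END site** (`m = 0`): `X_H h_0 = -j_0` — energy leaves site `0` only through the bond
`(0, 1)`; there is no inflow bond. [folklore] -/
theorem liouvilleOp_siteEnergy_zero (hm : m.val = 0) (x : PhaseSpace N) :
    liouvilleOp (pinnedChain ω₂ lam β 0) N X x = -(pinnedChain ω₂ lam β 0).bondCurrent N m x := by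
  have hU : Differentiable ℝ (pinnedChain ω₂ lam β 0).U :=
    (pinnedChain_contDiff_U ω₂ lam β 0 (n := 1)).differentiable one_ne_zero
  have hV : Differentiable ℝ (pinnedChain ω₂ lam β 0).V :=
    (pinnedChain_contDiff_V ω₂ lam β 0 (n := 1)).differentiable one_ne_zero
  rw [liouvilleOp_eq_poisson, poisson_hamiltonian_weightedEnergy (pinnedChain ω₂ lam β 0) _ X hX hU hV]
  unfold OscillatorChain.bondCurrent
  rw [← Finset.sum_neg_distrib, Finset.sum_eq_single_of_mem m (Finset.mem_univ _)]
  · refine Finset.sum_congr rfl fun l _ => ?_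
    by_cases hl : l.val = m.val + 1
    · have hlm : l ≠ m := fun e => by rw [e] at hl; omega
      rw [if_pos hl, if_pos hl, if_neg hlm, if_pos rfl]; ring
    · rw [if_neg hl, if_neg hl]; ring
  · intro k _ hk
    refine Finset.sum_eq_zero fun l _ => ?_
    by_cases hl : l.val = k.val + 1
    · have hlm : l ≠ m := fun e => by rw [e] at hl; omega
      rw [if_pos hl, if_neg hlm, if_neg hk]; ring
    · rw [if_neg hl]

omit hω in
/-- **The site energy along the closed flow is controlled by the time-integrated adjacent currents (interior / right
site `m = i + 1`)**: `h_m(Φ_t x) ≤ h_m(x) + ∫₀ᵗ (|j_i(Φ_τ x)| + |j_m(Φ_τ x)|) dτ` for `t ≥ 0`. [folklore] -/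
theorem siteEnergy_detFlow_le_interior (hω' : 0 < ω₂) {i : Fin N} (him : m.val = i.val + 1) (x : PhaseSpace N)
    {t : ℝ} (ht : 0 ≤ t) :
    X (ClosedConeSensitivity.Negative.ZeroFrictionDictionary.detFlow ω₂ lam β N t x) ≤ X x +
      ∫ τ in (0 : ℝ)..t, (|(pinnedChain ω₂ lam β 0).bondCurrent N i
          (ClosedConeSensitivity.Negative.ZeroFrictionDictionary.detFlow ω₂ lam β N τ x)| +
        |(pinnedChain ω₂ lam β 0).bondCurrent N m
          (ClosedConeSensitivity.Negative.ZeroFrictionDictionary.detFlow ω₂ lam β N τ x)|) := by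
  have hU : Differentiable ℝ (pinnedChain ω₂ lam β 0).U :=
    (pinnedChain_contDiff_U ω₂ lam β 0 (n := 1)).differentiable one_ne_zero
  have hV : Differentiable ℝ (pinnedChain ω₂ lam β 0).V :=
    (pinnedChain_contDiff_V ω₂ lam β 0 (n := 1)).differentiable one_ne_zero
  have hX1 : ContDiff ℝ 1 X := contDiff_siteEnergy m X hX
  have h := comp_detFlow_sub_eq_integral hω' hl hβ 0 N hX1 ht x
  have hL : ∀ z, liouvilleOp (pinnedChain ω₂ lam β 0) N X z =
      (pinnedChain ω₂ lam β 0).bondCurrent N i z - (pinnedChain ω₂ lam β 0).bondCurrent N m z := fun z =>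
    liouvilleOp_siteEnergy (pinnedChain ω₂ lam β 0) m X hX hU hV him z
  simp only [hL] at h
  have hcont : ∀ k : Fin N, Continuous fun τ => (pinnedChain ω₂ lam β 0).bondCurrent N k
      (ClosedConeSensitivity.Negative.ZeroFrictionDictionary.detFlow ω₂ lam β N τ x) := fun k =>
    (pinnedChain_continuous_bondCurrent ω₂ lam β 0 N k).comp (continuous_detFlow_time hω' hl hβ N x)
  have hle : ∫ τ in (0 : ℝ)..t, ((pinnedChain ω₂ lam β 0).bondCurrent N i
        (ClosedConeSensitivity.Negative.ZeroFrictionDictionary.detFlow ω₂ lam β N τ x) -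
      (pinnedChain ω₂ lam β 0).bondCurrent N m (ClosedConeSensitivity.Negative.ZeroFrictionDictionary.detFlow ω₂ lam β N τ x)) ≤
      ∫ τ in (0 : ℝ)..t, (|(pinnedChain ω₂ lam β 0).bondCurrent N i
        (ClosedConeSensitivity.Negative.ZeroFrictionDictionary.detFlow ω₂ lam β N τ x)| +
      |(pinnedChain ω₂ lam β 0).bondCurrent N m (ClosedConeSensitivity.Negative.ZeroFrictionDictionary.detFlow ω₂ lam β N τ x)|) := by
    refine intervalIntegral.integral_mono_on ht (((hcont i).sub (hcont m)).intervalIntegrable _ _)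
      (((hcont i).abs.add (hcont m).abs).intervalIntegrable _ _) fun τ _ => ?_
    have h1 := le_abs_self ((pinnedChain ω₂ lam β 0).bondCurrent N i (ClosedConeSensitivity.Negative.ZeroFrictionDictionary.detFlow ω₂ lam β N τ x))
    have h2 := neg_abs_le ((pinnedChain ω₂ lam β 0).bondCurrent N m (ClosedConeSensitivity.Negative.ZeroFrictionDictionary.detFlow ω₂ lam β N τ x))
    linarith
  linarith

omit hω in
/-- **The site energy along the closed flow at the LEFT END site `m = 0`**:
`h_0(Φ_t x) ≤ h_0(x) + ∫₀ᵗ |j_0(Φ_τ x)| dτ` for `t ≥ 0`. [folklore] -/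
theorem siteEnergy_detFlow_le_zero (hω' : 0 < ω₂) (hm : m.val = 0) (x : PhaseSpace N) {t : ℝ} (ht : 0 ≤ t) :
    X (ClosedConeSensitivity.Negative.ZeroFrictionDictionary.detFlow ω₂ lam β N t x) ≤ X x +
      ∫ τ in (0 : ℝ)..t, |(pinnedChain ω₂ lam β 0).bondCurrent N m
          (ClosedConeSensitivity.Negative.ZeroFrictionDictionary.detFlow ω₂ lam β N τ x)| := by
  have hX1 : ContDiff ℝ 1 X := contDiff_siteEnergy m X hX
  have h := comp_detFlow_sub_eq_integral hω' hl hβ 0 N hX1 ht x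
  have hL : ∀ z, liouvilleOp (pinnedChain ω₂ lam β 0) N X z = -(pinnedChain ω₂ lam β 0).bondCurrent N m z :=
    fun z => liouvilleOp_siteEnergy_zero m X hX hm z
  simp only [hL] at h
  have hcont : Continuous fun τ => (pinnedChain ω₂ lam β 0).bondCurrent N m
      (ClosedConeSensitivity.Negative.ZeroFrictionDictionary.detFlow ω₂ lam β N τ x) :=
    (pinnedChain_continuous_bondCurrent ω₂ lam β 0 N m).comp (continuous_detFlow_time hω' hl hβ N x)
  have hle : ∫ τ in (0 : ℝ)..t, -(pinnedChain ω₂ lam β 0).bondCurrent N m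
        (ClosedConeSensitivity.Negative.ZeroFrictionDictionary.detFlow ω₂ lam β N τ x) ≤
      ∫ τ in (0 : ℝ)..t, |(pinnedChain ω₂ lam β 0).bondCurrent N m (ClosedConeSensitivity.Negative.ZeroFrictionDictionary.detFlow ω₂ lam β N τ x)| :=
    intervalIntegral.integral_mono_on ht (hcont.neg.intervalIntegrable _ _) (hcont.abs.intervalIntegrable _ _)
      fun τ _ => neg_le_abs _
  linarith

end Pinned

/-! ### Registered sub-goal of the line (closed form of `siteEnergy_detFlow_le_interior`) -/

/-- **Sub-goal `stub_blockEnergyBalance`** (registered on the crux item for this helper file; closed `∀`-form of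
`siteEnergy_detFlow_le_interior`): the site energy along the closed flow is controlled by the time-integrated adjacent
currents. [folklore] -/
theorem stub_blockEnergyBalance : ∀ (ω₂ lam β : ℝ), 0 ≤ lam → 0 ≤ β → ∀ (N : ℕ) (m : Fin N) (X : PhaseSpace N → ℝ), X = (fun x => (∑ k : Fin N, (if k = m then (1 : ℝ) else 0) * (x.2 k ^ 2 / 2 + (pinnedChain ω₂ lam β 0).U (x.1 k))) + ∑ k : Fin N, ∑ l : Fin N, if l.val = k.val + 1 then ((if k = m then (1 : ℝ) else 0) + (if l = m then (1 : ℝ) else 0)) / 2 * (pinnedChain ω₂ lam β 0).V (x.1 l - x.1 k) else 0) → 0 < ω₂ → ∀ (i : Fin N), m.val = i.val + 1 → ∀ (x : PhaseSpace N) (t : ℝ), 0 ≤ t → X (Summit.AtomisticToContinuum.FouriersLaw.Theorems.ClosedConeSensitivity.Negative.ZeroFrictionDictionary.detFlow ω₂ lam β N t x) ≤ X x + ∫ τ in (0 : ℝ)..t, (|(pinnedChain ω₂ lam β 0).bondCurrent N i (Summit.AtomisticToContinuum.FouriersLaw.Theorems.ClosedConeSensitivity.Negative.ZeroFrictionDictionary.detFlow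 ω₂ lam β N τ x)| + |(pinnedChain ω₂ lam β 0).bondCurrent N m (Summit.AtomisticToContinuum.FouriersLaw.Theorems.ClosedConeSensitivity.Negative.ZeroFrictionDictionary.detFlow ω₂ lam β N τ x)|) :=
  fun _ _ _ hl hβ _ m X hX hω' _ him x _ ht => siteEnergy_detFlow_le_interior hl hβ m X hX hω' him x ht

end Summit.AtomisticToContinuum.FouriersLaw.Theorems.OddSectorIrreversibility.TapLeak

end
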